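import Literature.Geometry.Lorentzian.ConformalCoordCurvature
import HarnessLib

/-!
# Scale invariance of the coordinate Ricci tensor: `Ric(a·G) = Ric(G)` for a constant `a ≠ 0`

Pure Fréchet calculus in the `MetricCoord` framework: the special case of Besse's formula for
conformal changes (`IsMetricOn.ricAt_conformal`, `ConformalCoordCurvature.lean`, Besse 1987,
Thm. 1.159 (d)) with a CONSTANT conformal factor, where the conformal one-form `θ = dc/(2c)`,
its Hessian and all correction terms vanish: `IsMetricOn.ricAt_const_smul`. This is how the
Ricci tensor of the rescaled pulled-back metric `r⁻² ψ^* g` of an `ε`-neck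
(`Literature.Geometry.Riemannian.neckPullback`, `CkNecks.lean`) is identified with that of
`ψ^* g` itself (R. Hamilton, Comm. Anal. Geom. 5 (1997), §C2: "the Ricci tensor is invariant
under scaling"). Everything is proved; no definitions, no named facts.

## References

* A. L. Besse, *Einstein manifolds*, Springer 1987, Thm. 1.159 (d). [Besse1987]
* R. S. Hamilton, *Four-manifolds with positive isotropic curvature*, Comm. Anal. Geom. 5 (1997),
  §C2, p. 31. [Hamilton1997]
-/

noncomputable section

set_option maxSynthPendingDepth 3

open Set Filter ContinuousLinearMap Module
open scoped Topology ContDiff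

namespace Literature.Geometry.Lorentzian

namespace MetricCoord

section Scaling

variable {E : Type*} [NormedAddCommGroup E] [NormedSpace ℝ E]
  {G : E → E →L[ℝ] E →L[ℝ] ℝ} {V : Set E} {x : E} {a : ℝ}

/-- The conformal one-form of a constant factor vanishes: `θ = d a/(2a) = 0`. [folklore] -/
theorem confForm_const_apply (y v : E) : confForm (fun _ : E ↦ a) y v = 0 := by
  rw [confForm_apply, fderiv_fun_const, Pi.zero_apply, zero_apply, mul_zero]

/-- The conformal one-form of a constant factor is the same (zero) covector at every point.
[folklore] -/
theorem confForm_const_eq (y : E) : confForm (fun _ : E ↦ a) y = confForm (fun _ : E ↦ a) x := by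
  ext v
  rw [confForm_const_apply, confForm_const_apply]

/-- Hence its derivative vanishes. [folklore] -/
theorem fderiv_confForm_const (x : E) : fderiv ℝ (confForm (fun _ : E ↦ a)) x = 0 := by
  have h1 := hasFDerivAt_const (𝕜 := ℝ) (confForm (fun _ : E ↦ a) x) x
  have h2 : confForm (fun _ : E ↦ a) =ᶠ[𝓝 x] fun _ : E ↦ confForm (fun _ : E ↦ a) x :=
    Filter.Eventually.of_forall fun y ↦ confForm_const_eq (x := x) y
  exact (h1.congr_of_eventuallyEq h2).fderiv

/-- The Hessian of the (constant) conformal exponent vanishes. [folklore] -/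
theorem confHess_const_apply (x v w : E) : confHess G (fun _ : E ↦ a) x v w = 0 := by
  rw [confHess_apply, fderiv_confForm_const, confForm_const_apply]
  simp

/-- The Hessian of the constant conformal exponent is the zero form. [folklore] -/
theorem confHess_const_eq_zero_smul (x : E) :
    confHess G (fun _ : E ↦ a) x = (0 : ℝ) • confHess G (fun _ : E ↦ a) x := by
  ext v w
  rw [confHess_const_apply, smul_apply, smul_apply, confHess_const_apply, smul_eq_mul, mul_zero]

variable [FiniteDimensional ℝ E] [CompleteSpace E]

/-- **Scale invariance of the Ricci tensor**: `Ric(a·G)ₓ(Y, Z) = Ric(G)ₓ(Y, Z)` for a constant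
`a ≠ 0` and metric components `G` on an open `V ∋ x` (Besse's conformal formula with `θ = 0`).
[cite: Besse1987, Thm. 1.159 (d)] -/
theorem IsMetricOn.ricAt_const_smul (hG : IsMetricOn G V) (hx : x ∈ V) (ha : a ≠ 0) (Y Z : E) :
    ricAt (fun y ↦ a • G y) x Y Z = ricAt G x Y Z := by
  have htr : mtrAt G x (confHess G (fun _ : E ↦ a) x) = 0 := by
    rw [confHess_const_eq_zero_smul (G := G) (a := a) x, mtrAt_smul, zero_mul]
  rw [hG.ricAt_conformal (c := fun _ : E ↦ a) contDiffOn_const (fun _ _ ↦ ha) hx Y Z,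
    confHess_const_apply, confForm_const_apply, confForm_const_apply, confForm_const_apply, htr]
  ring

/-- The same as an identity of bilinear forms. [cite: Besse1987, Thm. 1.159 (d)] -/
theorem IsMetricOn.ricAt_const_smul_eq (hG : IsMetricOn G V) (hx : x ∈ V) (ha : a ≠ 0) :
    ricAt (fun y ↦ a • G y) x = ricAt G x := by
  ext Y Z
  exact hG.ricAt_const_smul hx ha Y Z

end Scaling

end MetricCoord

end Literature.Geometry.Lorentzian

end
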